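import Mathlib
import Literature.Probability.LatticeModels.GKSInequalities
import Summits.CriticalPhenomena.Ising3DConformalLimit.Theorems.PrecisionLaplacianInverseMFerromagnetLevelThreeAux
import Summits.CriticalPhenomena.Ising3DConformalLimit.Theorems.PrecisionLaplacianInverseMFerromagnetImOfPcm
import HarnessLib

/-!
# Crux `PrecisionLaplacian.InverseMFerromagnet` (stmt-CriticalPhenomena-4798), line `Sketch` —
# auxiliary lemmas for stub `stub_imNonadj_of_law2` (C2: non-adjacent pairs of degree ≤ 3 from `Law₂`)

THEOREM-ONLY helper file (no definitions), zero-field spin systems `gksExpect s K C` on `Fin n`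
(single-spin flips `ω ↦ ω * Pi.mulSingle x (-1)` as in `…ImOfPcm.lean`): three-spin identities
(`c2_three`: Walsh form of `tanh (∑ⱼ aⱼσⱼ)` with cubic coefficient `κ ≤ 0`, star–triangle form of
`cosh (∑ⱼ aⱼσⱼ)`, `J ≥ 0`); integrating out one spin (`c2_integrate` = `helper_c2_decimate`), free spins,
decimation (`c2_free`, `c2_decimate`); local fields (`c2_site`); residuals (`c2_res_lin`, `c2_res_symm`).
-/

namespace Summit.CriticalPhenomena.Ising3DConformalLimit.Cruxes.InverseMFerromagnet.PartialCovarianceLadder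

open Literature.Probability.LatticeModels Finset Matrix

/-- `(1 - tanh u) eᵘ = (1 + tanh u) e⁻ᵘ`. [folklore] -/
theorem c2_tanh_key (u : ℝ) :
    (1 - Real.tanh u) * Real.exp u = (1 + Real.tanh u) * Real.exp (-u) := by
  have hc : Real.cosh u ≠ 0 := (Real.cosh_pos u).ne'
  rw [Real.tanh_eq_sinh_div_cosh]
  field_simp
  rw [Real.sinh_eq, Real.cosh_eq]
  ring

/-- `tanh p + tanh q = sinh (p + q) / (cosh p cosh q)`. [folklore] -/
theorem c2_tanh_add (p q : ℝ) :
    Real.tanh p + Real.tanh q = Real.sinh (p + q) / (Real.cosh p * Real.cosh q) := by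
  rw [Real.tanh_eq_sinh_div_cosh, Real.tanh_eq_sinh_div_cosh, Real.sinh_add,
    div_add_div _ _ (Real.cosh_pos p).ne' (Real.cosh_pos q).ne']

/-- Monotonicity of `cosh P cosh Q = (cosh (P+Q) + cosh (P-Q))/2` in `|P ± Q|`. [folklore] -/
theorem c2_cosh_prod_le {P Q P' Q' : ℝ} (h1 : (P + Q) ^ 2 ≤ (P' + Q') ^ 2)
    (h2 : (P - Q) ^ 2 ≤ (P' - Q') ^ 2) : Real.cosh P * Real.cosh Q ≤ Real.cosh P' * Real.cosh Q' := by
  have := Real.cosh_le_cosh.2 (sq_le_sq.1 h1)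
  have := Real.cosh_le_cosh.2 (sq_le_sq.1 h2)
  linarith [Real.cosh_add P Q, Real.cosh_sub P Q, Real.cosh_add P' Q', Real.cosh_sub P' Q']

/-- The sign of the cubic Walsh coefficient of `tanh (a s + b t + c r)`:
`tanh(a+b+c) + tanh(a-b-c) ≤ tanh(a+b-c) + tanh(a-b+c)` for `a, b, c ≥ 0`. [folklore] -/
theorem c2_kappa {a b c : ℝ} (ha : 0 ≤ a) (hb : 0 ≤ b) (hc : 0 ≤ c) :
    Real.tanh (a + b + c) + Real.tanh (a - b - c) ≤ Real.tanh (a + b - c) + Real.tanh (a - b + c) := by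
  rw [c2_tanh_add, c2_tanh_add, show a + b + c + (a - b - c) = a + b - c + (a - b + c) by ring]
  exact div_le_div_of_nonneg_left (Real.sinh_nonneg_iff.2 (by linarith))
    (mul_pos (Real.cosh_pos _) (Real.cosh_pos _))
    (c2_cosh_prod_le (by linarith) (by linarith [mul_nonneg hb hc]))

/-- **Three spins.** For `a ≥ 0`, on `{±1}³`: `tanh (∑ aⱼ σⱼ) = ∑ αⱼ σⱼ + κ σ₀σ₁σ₂` with `κ ≤ 0`
(Walsh form), `cosh (∑ aⱼ σⱼ) = e^c · exp (J₀σ₁σ₂ + J₁σ₀σ₂ + J₂σ₀σ₁)` with `J ≥ 0` (star–triangle). [folklore] -/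
theorem c2_three (a : Fin 3 → ℝ) (ha : ∀ j, 0 ≤ a j) :
    ∃ (α : Fin 3 → ℝ) (κ c : ℝ) (J : Fin 3 → ℝ), κ ≤ 0 ∧ (∀ j, 0 ≤ J j) ∧
      ∀ σ : Fin 3 → ℝ, (∀ j, σ j = 1 ∨ σ j = -1) →
        Real.tanh (∑ j, a j * σ j) = ∑ j, α j * σ j + κ * (σ 0 * σ 1 * σ 2) ∧
        Real.cosh (∑ j, a j * σ j)
          = Real.exp c * Real.exp (J 0 * (σ 1 * σ 2) + J 1 * (σ 0 * σ 2) + J 2 * (σ 0 * σ 1)) := by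
  have key : ∀ P Q P' Q' : ℝ, (P + Q) ^ 2 ≤ (P' + Q') ^ 2 → (P - Q) ^ 2 ≤ (P' - Q') ^ 2 →
      Real.log (Real.cosh P) + Real.log (Real.cosh Q)
        ≤ Real.log (Real.cosh P') + Real.log (Real.cosh Q') := by
    intro P Q P' Q' h1 h2
    rw [← Real.log_mul (Real.cosh_pos _).ne' (Real.cosh_pos _).ne',
      ← Real.log_mul (Real.cosh_pos _).ne' (Real.cosh_pos _).ne']
    exact Real.log_le_log (mul_pos (Real.cosh_pos _) (Real.cosh_pos _)) (c2_cosh_prod_le h1 h2)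
  have h0 := ha 0; have h1 := ha 1; have h2 := ha 2
  have e1 := key (a 0 + a 1 - a 2) (a 0 - a 1 + a 2) (a 0 + a 1 + a 2) (a 0 - a 1 - a 2)
    (by linarith) (by linarith [mul_nonneg h1 h2])
  have e2 := key (a 0 + a 1 - a 2) (a 0 - a 1 - a 2) (a 0 + a 1 + a 2) (a 0 - a 1 + a 2)
    (by linarith [mul_nonneg h0 h2]) (by linarith)
  have e3 := key (a 0 - a 1 + a 2) (a 0 - a 1 - a 2) (a 0 + a 1 + a 2) (a 0 + a 1 - a 2)
    (by linarith [mul_nonneg h0 h1]) (by linarith)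
  refine ⟨![(Real.tanh (a 0 + a 1 + a 2) + Real.tanh (a 0 + a 1 - a 2)
        + Real.tanh (a 0 - a 1 + a 2) + Real.tanh (a 0 - a 1 - a 2)) / 4,
      (Real.tanh (a 0 + a 1 + a 2) + Real.tanh (a 0 + a 1 - a 2)
        - Real.tanh (a 0 - a 1 + a 2) - Real.tanh (a 0 - a 1 - a 2)) / 4,
      (Real.tanh (a 0 + a 1 + a 2) - Real.tanh (a 0 + a 1 - a 2)
        + Real.tanh (a 0 - a 1 + a 2) - Real.tanh (a 0 - a 1 - a 2)) / 4],
    (Real.tanh (a 0 + a 1 + a 2) - Real.tanh (a 0 + a 1 - a 2)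
        - Real.tanh (a 0 - a 1 + a 2) + Real.tanh (a 0 - a 1 - a 2)) / 4,
    (Real.log (Real.cosh (a 0 + a 1 + a 2)) + Real.log (Real.cosh (a 0 + a 1 - a 2))
      + Real.log (Real.cosh (a 0 - a 1 + a 2)) + Real.log (Real.cosh (a 0 - a 1 - a 2))) / 4,
    ![(Real.log (Real.cosh (a 0 + a 1 + a 2)) - Real.log (Real.cosh (a 0 + a 1 - a 2))
      - Real.log (Real.cosh (a 0 - a 1 + a 2)) + Real.log (Real.cosh (a 0 - a 1 - a 2))) / 4,
      (Real.log (Real.cosh (a 0 + a 1 + a 2)) - Real.log (Real.cosh (a 0 + a 1 - a 2))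
      + Real.log (Real.cosh (a 0 - a 1 + a 2)) - Real.log (Real.cosh (a 0 - a 1 - a 2))) / 4,
      (Real.log (Real.cosh (a 0 + a 1 + a 2)) + Real.log (Real.cosh (a 0 + a 1 - a 2))
      - Real.log (Real.cosh (a 0 - a 1 + a 2)) - Real.log (Real.cosh (a 0 - a 1 - a 2))) / 4],
    by linarith [c2_kappa h0 h1 h2], fun j => by fin_cases j <;> simp <;> linarith,
    fun σ hσ => ?_⟩
  have hn : ∀ u w : ℝ, u = -w → Real.tanh u = -Real.tanh w := fun u w h => by rw [h, Real.tanh_neg]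
  have n1 := hn (-a 0 + a 1 + a 2) (a 0 + -a 1 + -a 2) (by ring)
  have n2 := hn (-a 0 + a 1 + -a 2) (a 0 + -a 1 + a 2) (by ring)
  have n3 := hn (-a 0 + -a 1 + a 2) (a 0 + a 1 + -a 2) (by ring)
  have n4 := hn (-a 0 + -a 1 + -a 2) (a 0 + a 1 + a 2) (by ring)
  have hm : ∀ u w : ℝ, u = -w → Real.cosh u = Real.cosh w := fun u w h => by rw [h, Real.cosh_neg]
  have m1 := hm (-a 0 + a 1 + a 2) (a 0 + -a 1 + -a 2) (by ring)
  have m2 := hm (-a 0 + a 1 + -a 2) (a 0 + -a 1 + a 2) (by ring)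
  have m3 := hm (-a 0 + -a 1 + a 2) (a 0 + a 1 + -a 2) (by ring)
  have m4 := hm (-a 0 + -a 1 + -a 2) (a 0 + a 1 + a 2) (by ring)
  simp only [Fin.sum_univ_three, Matrix.cons_val_zero, Matrix.cons_val_one, Matrix.cons_val_two,
    Matrix.head_cons, Matrix.tail_cons]
  rw [← Real.exp_add]
  rcases hσ 0 with h0 | h0 <;> rcases hσ 1 with h1 | h1 <;> rcases hσ 2 with h2 | h2 <;>
    simp only [h0, h1, h2, mul_one, mul_neg_one, neg_neg, sub_eq_add_neg, n1, n2, n3, n4, m1, m2,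
      m3, m4] <;>
    exact ⟨by ring, (Real.exp_log (Real.cosh_pos _)).symm.trans (by congr 1; ring)⟩

/-- `σ_A` is invariant under the flip of a spin outside `A`. [folklore] -/
theorem c2_spinProduct_flip {n : ℕ} {A : Finset (Fin n)} {x : Fin n} (hx : x ∉ A)
    (ω : SpinConfig (Fin n)) : spinProduct A (ω * Pi.mulSingle x (-1)) = spinProduct A ω :=
  Finset.prod_congr rfl fun _ hz => pcm2im_spinAt_flip_ne (ne_of_mem_of_not_mem hz hx) ω

/-- A Hamiltonian whose bonds at `x` carry zero coupling is invariant under flipping `x`. [folklore] -/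
theorem c2_ham_flip {n : ℕ} {ι : Type*} (s : Finset ι) (K : ι → ℝ) (C : ι → Finset (Fin n))
    (x : Fin n) (hK : ∀ i ∈ s, x ∈ C i → K i = 0) (ω : SpinConfig (Fin n)) :
    gksHamiltonian s K C (ω * Pi.mulSingle x (-1)) = gksHamiltonian s K C ω := by
  refine Finset.sum_congr rfl fun i hi => ?_
  by_cases hx : x ∈ C i
  · simp [hK i hi hx]
  · rw [c2_spinProduct_flip hx]

/-- If `g + g ∘ flip_x = 0` pointwise then `∑ g = 0`. [folklore] -/
theorem c2_sum_flip_zero {n : ℕ} (x : Fin n) (g : SpinConfig (Fin n) → ℝ)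
    (hg : ∀ ω, g ω + g (ω * Pi.mulSingle x (-1)) = 0) : ∑ ω, g ω = 0 := by
  have h := Equiv.sum_comp (Equiv.mulRight (Pi.mulSingle x (-1) : SpinConfig (Fin n))) g
  simp only [Equiv.coe_mulRight] at h
  have h2 : ∑ ω, (g ω + g (ω * Pi.mulSingle x (-1))) = 0 := Finset.sum_eq_zero fun ω _ => hg ω
  rw [Finset.sum_add_distrib, h] at h2
  linarith

/-- **Integrating out one spin.** If `H = H' + σ_x h` with `H'`, `h` independent of `σ_x`, then for
`F` independent of `σ_x`: `⟨σ_x F⟩ = ⟨tanh(h) F⟩` and `∑_ω F e^H = ∑_ω cosh(h) F e^{H'}`. [folklore] -/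
theorem c2_integrate {n : ℕ} {ι : Type*} (s : Finset ι) (K K' : ι → ℝ) (C : ι → Finset (Fin n))
    (x : Fin n) (h : SpinConfig (Fin n) → ℝ)
    (hH : ∀ ω, gksHamiltonian s K C ω = gksHamiltonian s K' C ω + spinAt x ω * h ω)
    (hK' : ∀ i ∈ s, x ∈ C i → K' i = 0) (hh : ∀ ω, h (ω * Pi.mulSingle x (-1)) = h ω)
    (F : SpinConfig (Fin n) → ℝ) (hF : ∀ ω, F (ω * Pi.mulSingle x (-1)) = F ω) :
    gksExpect s K C (fun ω => spinAt x ω * F ω) = gksExpect s K C (fun ω => Real.tanh (h ω) * F ω)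
      ∧ gksSum s K C F = gksSum s K' C (fun ω => Real.cosh (h ω) * F ω) := by
  have hw : ∀ ω, gksWeight s K C ω = gksWeight s K' C ω * Real.exp (spinAt x ω * h ω) :=
    fun ω => by rw [gksWeight, gksWeight, hH, Real.exp_add]
  have hw0 : ∀ ω, gksWeight s K' C (ω * Pi.mulSingle x (-1)) = gksWeight s K' C ω :=
    fun ω => by rw [gksWeight, gksWeight, c2_ham_flip s K' C x hK']
  have hw' : ∀ ω, gksWeight s K C (ω * Pi.mulSingle x (-1))
      = gksWeight s K' C ω * Real.exp (-(spinAt x ω * h ω)) := fun ω => by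
    rw [hw, hw0, hh, pcm2im_spinAt_flip_same, neg_mul]
  have hch : ∀ u : ℝ, Real.exp u + Real.exp (-u) = 2 * Real.cosh u := fun u => by
    rw [Real.cosh_eq]; ring
  have h1 : gksSum s K C (fun ω => spinAt x ω * F ω)
      = gksSum s K C (fun ω => Real.tanh (h ω) * F ω) := by
    rw [← sub_eq_zero, gksSum, gksSum, ← Finset.sum_sub_distrib]
    refine c2_sum_flip_zero x _ fun ω => ?_
    rw [hF, hh, pcm2im_spinAt_flip_same, hw', hw]
    rcases spinAt_eq_one_or_eq_neg_one x ω with h1 | h1 <;> rw [h1] <;>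
      simp only [one_mul, neg_one_mul, neg_neg] <;>
      linear_combination (F ω * gksWeight s K' C ω) * c2_tanh_key (h ω)
  refine ⟨by unfold gksExpect; rw [h1], ?_⟩
  rw [← sub_eq_zero, gksSum, gksSum, ← Finset.sum_sub_distrib]
  refine c2_sum_flip_zero x _ fun ω => ?_
  rw [hF, hh, hw', hw, hw0]
  rcases spinAt_eq_one_or_eq_neg_one x ω with h1 | h1 <;> rw [h1] <;>
    simp only [one_mul, neg_one_mul, neg_neg] <;>
    linear_combination (F ω * gksWeight s K' C ω) * hch (h ω)

/-- Free spins: if every bond at `z` has zero coupling, `⟨σ_z F⟩ = 0` (`F` indep. of `σ_z`). [folklore] -/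
theorem c2_free {n : ℕ} {ι : Type*} [Fintype ι] (K : ι → ℝ) (C : ι → Finset (Fin n)) (z : Fin n)
    (hK : ∀ i, z ∈ C i → K i = 0) (F : SpinConfig (Fin n) → ℝ)
    (hF : ∀ ω, F (ω * Pi.mulSingle z (-1)) = F ω) :
    gksExpect Finset.univ K C (fun ω => spinAt z ω * F ω) = 0 := by
  have h := (c2_integrate Finset.univ K K C z (fun _ => 0) (fun ω => by simp) (fun i _ => hK i)
    (fun _ => rfl) F hF).1
  simp only [Real.tanh_zero, zero_mul] at h
  rw [h]
  simp [gksExpect, gksSum]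

/-- **Decimation of two non-adjacent spins.** If `H = Hˣ + σ_x h_x`, `Hˣ = Hˣʸ + σ_y h_y`,
`cosh h_x = e^{c_x} e^{S_x}`, `cosh h_y = e^{c_y} e^{S_y}` (obvious independences), observables
independent of `σ_x, σ_y` have the same expectation under `H` and under `Hˣʸ + S_x + S_y`. [folklore] -/
theorem c2_decimate {n : ℕ} {ι ι₂ : Type*} [Fintype ι] [Fintype ι₂] (K Kx Kxy : ι → ℝ)
    (C : ι → Finset (Fin n)) (K₂ : ι₂ → ℝ) (C₂ : ι₂ → Finset (Fin n)) (x y : Fin n)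
    (hx hy Sx Sy : SpinConfig (Fin n) → ℝ) (cx cy : ℝ)
    (hH1 : ∀ ω, gksHamiltonian Finset.univ K C ω
      = gksHamiltonian Finset.univ Kx C ω + spinAt x ω * hx ω)
    (hH2 : ∀ ω, gksHamiltonian Finset.univ Kx C ω
      = gksHamiltonian Finset.univ Kxy C ω + spinAt y ω * hy ω)
    (hKx : ∀ i, x ∈ C i → Kx i = 0) (hKxy : ∀ i, y ∈ C i → Kxy i = 0)
    (hhx : ∀ ω, hx (ω * Pi.mulSingle x (-1)) = hx ω)
    (hhx' : ∀ ω, hx (ω * Pi.mulSingle y (-1)) = hx ω)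
    (hhy : ∀ ω, hy (ω * Pi.mulSingle y (-1)) = hy ω)
    (hSx : ∀ ω, Real.cosh (hx ω) = Real.exp cx * Real.exp (Sx ω))
    (hSy : ∀ ω, Real.cosh (hy ω) = Real.exp cy * Real.exp (Sy ω))
    (hH₂ : ∀ ω, gksHamiltonian Finset.univ K₂ C₂ ω
      = gksHamiltonian Finset.univ Kxy C ω + Sx ω + Sy ω)
    (f : SpinConfig (Fin n) → ℝ) (hfx : ∀ ω, f (ω * Pi.mulSingle x (-1)) = f ω)
    (hfy : ∀ ω, f (ω * Pi.mulSingle y (-1)) = f ω) :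
    gksExpect Finset.univ K C f = gksExpect Finset.univ K₂ C₂ f := by
  have key : ∀ g : SpinConfig (Fin n) → ℝ, (∀ ω, g (ω * Pi.mulSingle x (-1)) = g ω) →
      (∀ ω, g (ω * Pi.mulSingle y (-1)) = g ω) →
      gksSum Finset.univ K C g = Real.exp (cx + cy) * gksSum Finset.univ K₂ C₂ g := by
    intro g hgx hgy
    rw [(c2_integrate Finset.univ K Kx C x hx hH1 (fun i _ => hKx i) hhx g hgx).2,
      (c2_integrate Finset.univ Kx Kxy C y hy hH2 (fun i _ => hKxy i) hhy _
        (fun ω => by simp only [hhx', hgy])).2]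
    simp only [gksSum, gksWeight, hH₂, hSx, hSy, Real.exp_add, Finset.mul_sum]
    exact Finset.sum_congr rfl fun ω _ => by ring
  rw [gksExpect, gksExpect, key f hfx hfy, key (fun _ => 1) (fun _ => rfl) (fun _ => rfl),
    mul_div_mul_left _ _ (Real.exp_pos _).ne']

/-- Re-indexing the bonds along an equivalence does not change expectations. [folklore] -/
theorem c2_reindex {Λ ι ι' : Type*} [Fintype Λ] [DecidableEq Λ] [Fintype ι] [Fintype ι']
    (e : ι ≃ ι') (K : ι → ℝ) (C : ι → Finset Λ) (f : SpinConfig Λ → ℝ) :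
    gksExpect Finset.univ (K ∘ e.symm) (C ∘ e.symm) f = gksExpect Finset.univ K C f := by
  have hH : ∀ ω, gksHamiltonian Finset.univ (K ∘ e.symm) (C ∘ e.symm) ω
      = gksHamiltonian Finset.univ K C ω := fun ω => by
    simp only [gksHamiltonian, Function.comp_apply]
    exact Equiv.sum_comp e.symm (fun i => K i * spinProduct (C i) ω)
  simp only [gksExpect, gksSum, gksWeight, hH]

/-- A nonnegative combination `∑_{i ∈ F} K_i σ(o_i)`, `|F| ≤ 3`, as exactly three slots
`∑_{j < 3} a_j σ(v_j)` (padding with zero couplings at a default site `d`). [folklore] -/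
theorem c2_slots {ι V : Type*} [DecidableEq ι] (F : Finset ι) (hF : F.card ≤ 3) (Kf : ι → ℝ)
    (o : ι → V) (P : V → Prop) (d : V) (hd : P d) (ho : ∀ i ∈ F, P (o i))
    (hK : ∀ i ∈ F, 0 ≤ Kf i) :
    ∃ (a : Fin 3 → ℝ) (v : Fin 3 → V), (∀ j, 0 ≤ a j) ∧ (∀ j, P (v j)) ∧
      ∀ σ : V → ℝ, ∑ i ∈ F, Kf i * σ (o i) = ∑ j, a j * σ (v j) := by
  obtain h | h | h | h : F.card = 0 ∨ F.card = 1 ∨ F.card = 2 ∨ F.card = 3 := by omega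
  · rw [Finset.card_eq_zero] at h
    subst h
    exact ⟨0, fun _ => d, fun _ => le_rfl, fun _ => hd, fun σ => by simp⟩
  · obtain ⟨i, rfl⟩ := Finset.card_eq_one.1 h
    exact ⟨![Kf i, 0, 0], ![o i, d, d], fun j => by fin_cases j <;> simp [hK i (by simp)],
      fun j => by fin_cases j <;> simp [ho i (by simp), hd], fun σ => by simp [Fin.sum_univ_three]⟩
  · obtain ⟨i, k, hik, rfl⟩ := Finset.card_eq_two.1 h
    exact ⟨![Kf i, Kf k, 0], ![o i, o k, d],
      fun j => by fin_cases j <;> simp [hK i (by simp), hK k (by simp)],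
      fun j => by fin_cases j <;> simp [ho i (by simp), ho k (by simp), hd],
      fun σ => by rw [Finset.sum_pair hik]; simp [Fin.sum_univ_three]⟩
  · obtain ⟨i, k, l, hik, hil, hkl, rfl⟩ := Finset.card_eq_three.1 h
    exact ⟨![Kf i, Kf k, Kf l], ![o i, o k, o l],
      fun j => by fin_cases j <;> simp [hK i (by simp), hK k (by simp), hK l (by simp)],
      fun j => by fin_cases j <;> simp [ho i (by simp), ho k (by simp), ho l (by simp)],
      fun σ => by
        rw [Finset.sum_insert (by simp [hik, hil]), Finset.sum_pair hkl]
        simp [Fin.sum_univ_three, add_assoc]⟩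

/-- **The local field at `x`** (pair system, `x` non-adjacent to `y`, `deg x ≤ 3`): `H = Hˣ + σ_x
∑_{j<3} a_j σ_{v_j}`, `a_j ≥ 0`, `v_j ∉ {x, y}`, `Hˣ` = `H` with the bonds at `x` off (for every `K' = K` at `x`). [folklore] -/
theorem c2_site {n m : ℕ} (K : Fin m → ℝ) (C : Fin m → Finset (Fin n)) (hK : ∀ i, 0 ≤ K i)
    (hC : ∀ i, (C i).card = 2) (x y : Fin n) (hxy : ∀ i, ¬ (x ∈ C i ∧ y ∈ C i))
    (hdeg : (Finset.univ.filter fun i => x ∈ C i).card ≤ 3) (d : Fin n) (hd : d ≠ x ∧ d ≠ y) :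
    ∃ (a : Fin 3 → ℝ) (v : Fin 3 → Fin n), (∀ j, 0 ≤ a j) ∧ (∀ j, v j ≠ x ∧ v j ≠ y) ∧
      ∀ K' : Fin m → ℝ, (∀ i, x ∈ C i → K' i = K i) → ∀ ω, gksHamiltonian Finset.univ K' C ω
        = gksHamiltonian Finset.univ (fun i => if x ∈ C i then 0 else K' i) C ω
          + spinAt x ω * ∑ j, a j * spinAt (v j) ω := by
  have hex : ∀ i, ∃ p, x ∈ C i → (p ≠ x ∧ p ≠ y) ∧ C i = {x, p} := by
    intro i
    by_cases hx : x ∈ C i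
    · obtain ⟨p, q, hpq, hCi⟩ := Finset.card_eq_two.1 (hC i)
      have hy : y ∉ C i := fun h => hxy i ⟨hx, h⟩
      rw [hCi, Finset.mem_insert, Finset.mem_singleton] at hx hy
      rcases hx with rfl | rfl
      · exact ⟨q, fun _ => ⟨⟨hpq.symm, fun h => hy (Or.inr h.symm)⟩, hCi⟩⟩
      · exact ⟨p, fun _ => ⟨⟨hpq, fun h => hy (Or.inl h.symm)⟩, hCi.trans (Finset.pair_comm _ _)⟩⟩
    · exact ⟨x, fun h => absurd h hx⟩
  choose o ho using hex
  obtain ⟨a, v, ha, hv, hsum⟩ := c2_slots (Finset.univ.filter fun i => x ∈ C i) hdeg K o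
    (fun p => p ≠ x ∧ p ≠ y) d hd (fun i hi => (ho i (Finset.mem_filter.1 hi).2).1) (fun i _ => hK i)
  refine ⟨a, v, ha, hv, fun K' hK' ω => ?_⟩
  rw [← hsum (fun p => spinAt p ω), Finset.sum_filter]
  simp only [gksHamiltonian, Finset.mul_sum, ← Finset.sum_add_distrib]
  refine Finset.sum_congr rfl fun i _ => ?_
  by_cases hx : x ∈ C i
  · obtain ⟨⟨hox, -⟩, hCi⟩ := ho i hx
    rw [if_pos hx, if_pos hx, hK' i hx, hCi, spinProduct, Finset.prod_pair hox.symm]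
    ring
  · simp [hx]

/-- If three slots are not pairwise distinct, their spin product is a single spin. [folklore] -/
theorem c2_cube_degen {n : ℕ} (v : Fin 3 → Fin n) (h : ¬ (v 0 ≠ v 1 ∧ v 0 ≠ v 2 ∧ v 1 ≠ v 2)) :
    ∃ j : Fin 3, ∀ ω : SpinConfig (Fin n),
      spinAt (v 0) ω * spinAt (v 1) ω * spinAt (v 2) ω = spinAt (v j) ω := by
  by_cases h01 : v 0 = v 1
  · exact ⟨2, fun ω => by rw [h01, spinAt_mul_self, one_mul]⟩
  by_cases h02 : v 0 = v 2
  · exact ⟨1, fun ω => by rw [h02, mul_right_comm, spinAt_mul_self, one_mul]⟩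
  · have h12 : v 1 = v 2 := by tauto
    exact ⟨0, fun ω => by rw [h12, mul_assoc, spinAt_mul_self, mul_one]⟩

/-- `σ_{{p,q}} = σ_p σ_q` for `p ≠ q`. [folklore] -/
theorem c2_spinProduct_pair {n : ℕ} {p q : Fin n} (h : p ≠ q) (ω : SpinConfig (Fin n)) :
    spinProduct {p, q} ω = spinAt p ω * spinAt q ω := by
  rw [spinProduct, Finset.prod_pair h]

/-- `σ_{{p,q,r}} = σ_p σ_q σ_r` for pairwise distinct `p, q, r`. [folklore] -/
theorem c2_spinProduct_three {n : ℕ} {p q r : Fin n} (hpq : p ≠ q) (hpr : p ≠ r) (hqr : q ≠ r)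
    (ω : SpinConfig (Fin n)) : spinProduct {p, q, r} ω = spinAt p ω * spinAt q ω * spinAt r ω := by
  rw [spinProduct, Finset.prod_insert (by simp [hpq, hpr]), Finset.prod_pair hqr, mul_assoc]

/-- `z ∉ {w₀, w₁, w₂}` when all `w_j ≠ z`. [folklore] -/
theorem c2_notMem_three {n : ℕ} (w : Fin 3 → Fin n) (z : Fin n) (h : ∀ j, w j ≠ z) :
    z ∉ ({w 0, w 1, w 2} : Finset (Fin n)) := by
  simp only [Finset.mem_insert, Finset.mem_singleton, not_or]
  exact ⟨(h 0).symm, (h 1).symm, (h 2).symm⟩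

/-- Pairing a function of the form `∑ αⱼ χ_{ιⱼ} + k e` against `W`. [folklore] -/
theorem c2_pair_lin {Ω S' J : Type*} [Fintype Ω] [Fintype J] (P : Ω → ℝ) (χ : S' → Ω → ℝ)
    (f e : Ω → ℝ) (ι : J → S') (α : J → ℝ) (k : ℝ)
    (hf : ∀ ω, f ω = ∑ j, α j * χ (ι j) ω + k * e ω) (W : Ω → ℝ) :
    ∑ ω, P ω * (f ω * W ω)
      = ∑ j, α j * ∑ ω, P ω * (χ (ι j) ω * W ω) + k * ∑ ω, P ω * (e ω * W ω) := by
  calc ∑ ω, P ω * (f ω * W ω) = ∑ ω, (P ω * W ω) * (∑ j, α j * χ (ι j) ω + k * e ω) :=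
        Finset.sum_congr rfl fun ω _ => by rw [hf]; ring
    _ = ∑ j, α j * ∑ ω, (P ω * W ω) * χ (ι j) ω + k * ∑ ω, (P ω * W ω) * e ω :=
        l3_sum_mul_lin_add _ _ _ (fun j ω => χ (ι j) ω) _
    _ = _ := by
        congr 1
        · exact Finset.sum_congr rfl fun j _ => by
            congr 1; exact Finset.sum_congr rfl fun ω _ => by ring
        · congr 1; exact Finset.sum_congr rfl fun ω _ => by ring

/-- **Residuals.** For the invertible Gram matrix `M_pq = ∑ P χ_p χ_q`, the residual pairing
`Res(f, g) = ∑ P f g − ∑_{p,q} (∑ P f χ_p) M⁻¹_pq (∑ P g χ_q)` satisfies `Res(∑ αⱼ χ_{ιⱼ} + k e, g) = k · Res(e, g)`. [folklore] -/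
theorem c2_res_lin {Ω S' J : Type*} [Fintype Ω] [Fintype S'] [DecidableEq S'] [Fintype J]
    (P : Ω → ℝ) (χ : S' → Ω → ℝ) (M : Matrix S' S' ℝ)
    (hM : ∀ p q, M p q = ∑ ω, P ω * (χ p ω * χ q ω)) (hdet : IsUnit M.det)
    (f e g : Ω → ℝ) (ι : J → S') (α : J → ℝ) (k : ℝ)
    (hf : ∀ ω, f ω = ∑ j, α j * χ (ι j) ω + k * e ω) :
    ∑ ω, P ω * (f ω * g ω)
        - ∑ p, ∑ q, (∑ ω, P ω * (f ω * χ p ω)) * M⁻¹ p q * (∑ ω, P ω * (g ω * χ q ω))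
      = k * (∑ ω, P ω * (e ω * g ω)
        - ∑ p, ∑ q, (∑ ω, P ω * (e ω * χ p ω)) * M⁻¹ p q * (∑ ω, P ω * (g ω * χ q ω))) := by
  have hMM : M * M⁻¹ = 1 := Matrix.mul_nonsing_inv M hdet
  have hcon : ∀ (W : S' → ℝ) (j : J), ∑ p, ∑ q, M (ι j) p * M⁻¹ p q * W q = W (ι j) := by
    intro W j
    calc ∑ p, ∑ q, M (ι j) p * M⁻¹ p q * W q = ∑ q, (M * M⁻¹) (ι j) q * W q := by
          rw [Finset.sum_comm]
          simp only [Matrix.mul_apply, Finset.sum_mul]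
      _ = W (ι j) := by simp [hMM, Matrix.one_apply]
  have h1 : ∀ p, ∑ ω, P ω * (f ω * χ p ω) = ∑ j, α j * M (ι j) p + k * ∑ ω, P ω * (e ω * χ p ω) :=
    fun p => by rw [c2_pair_lin P χ f e ι α k hf]; simp only [hM]
  have h2 : ∑ ω, P ω * (f ω * g ω)
      = ∑ j, α j * ∑ ω, P ω * (g ω * χ (ι j) ω) + k * ∑ ω, P ω * (e ω * g ω) := by
    rw [c2_pair_lin P χ f e ι α k hf]
    congr 1
    exact Finset.sum_congr rfl fun j _ => by
      congr 1; exact Finset.sum_congr rfl fun ω _ => by ring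
  have hterm : ∀ p q, (∑ ω, P ω * (f ω * χ p ω)) * M⁻¹ p q * (∑ ω, P ω * (g ω * χ q ω))
      = ∑ j, α j * (M (ι j) p * M⁻¹ p q * ∑ ω, P ω * (g ω * χ q ω))
        + k * ((∑ ω, P ω * (e ω * χ p ω)) * M⁻¹ p q * ∑ ω, P ω * (g ω * χ q ω)) := by
    intro p q
    rw [h1, add_mul, add_mul, Finset.sum_mul, Finset.sum_mul]
    congr 1
    · exact Finset.sum_congr rfl fun j _ => by ring
    · ring
  have h3 : ∑ p, ∑ q, (∑ ω, P ω * (f ω * χ p ω)) * M⁻¹ p q * (∑ ω, P ω * (g ω * χ q ω))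
      = ∑ j, α j * ∑ ω, P ω * (g ω * χ (ι j) ω)
        + k * ∑ p, ∑ q, (∑ ω, P ω * (e ω * χ p ω)) * M⁻¹ p q * (∑ ω, P ω * (g ω * χ q ω)) := by
    simp only [hterm, Finset.sum_add_distrib, ← Finset.mul_sum]
    congr 1
    calc ∑ p, ∑ q, ∑ j, α j * (M (ι j) p * M⁻¹ p q * ∑ ω, P ω * (g ω * χ q ω))
        = ∑ p, ∑ j, ∑ q, α j * (M (ι j) p * M⁻¹ p q * ∑ ω, P ω * (g ω * χ q ω)) :=
          Finset.sum_congr rfl fun p _ => Finset.sum_comm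
      _ = ∑ j, ∑ p, ∑ q, α j * (M (ι j) p * M⁻¹ p q * ∑ ω, P ω * (g ω * χ q ω)) :=
          Finset.sum_comm
      _ = ∑ j, α j * ∑ p, ∑ q, M (ι j) p * M⁻¹ p q * ∑ ω, P ω * (g ω * χ q ω) := by
          simp only [Finset.mul_sum]
      _ = _ := Finset.sum_congr rfl fun j _ => by rw [hcon]
  rw [h2, h3]
  ring

/-- Symmetry of the residual pairing `Res(u, v) = Res(v, u)` (symmetric Gram matrix). [folklore] -/
theorem c2_res_symm {Ω S' : Type*} [Fintype Ω] [Fintype S'] [DecidableEq S'] (P : Ω → ℝ)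
    (χ : S' → Ω → ℝ) (M : Matrix S' S' ℝ) (hM : ∀ p q, M p q = ∑ ω, P ω * (χ p ω * χ q ω))
    (u v : Ω → ℝ) :
    ∑ ω, P ω * (u ω * v ω)
        - ∑ p, ∑ q, (∑ ω, P ω * (u ω * χ p ω)) * M⁻¹ p q * (∑ ω, P ω * (v ω * χ q ω))
      = ∑ ω, P ω * (v ω * u ω)
        - ∑ p, ∑ q, (∑ ω, P ω * (v ω * χ p ω)) * M⁻¹ p q * (∑ ω, P ω * (u ω * χ q ω)) := by
  have hMt : Mᵀ = M := by
    ext p q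
    simp only [Matrix.transpose_apply, hM]
    exact Finset.sum_congr rfl fun ω _ => by ring
  have hinv : ∀ p q, M⁻¹ q p = M⁻¹ p q := fun p q => by
    rw [← Matrix.transpose_apply M⁻¹ p q, Matrix.transpose_nonsing_inv, hMt]
  congr 1
  · exact Finset.sum_congr rfl fun ω _ => by ring
  · rw [Finset.sum_comm]
    exact Finset.sum_congr rfl fun p _ => Finset.sum_congr rfl fun q _ => by rw [hinv]; ring

/-- Registered helper `helper_c2_decimate` (representative of this auxiliary file): the single-spin
decimation identity `∑ F e^H = ∑ cosh(h) F e^{H'}` for `H = H' + σ_x h` (`c2_integrate`). [folklore] -/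
theorem helper_c2_decimate : ∀ (n m : ℕ) (K K' : Fin m → ℝ) (C : Fin m → Finset (Fin n)) (x : Fin n) (h F : SpinConfig (Fin n) → ℝ), (∀ ω, gksHamiltonian Finset.univ K C ω = gksHamiltonian Finset.univ K' C ω + spinAt x ω * h ω) → (∀ i, x ∈ C i → K' i = 0) → (∀ ω, h (ω * Pi.mulSingle x (-1)) = h ω) → (∀ ω, F (ω * Pi.mulSingle x (-1)) = F ω) → gksSum Finset.univ K C F = gksSum Finset.univ K' C (fun ω => Real.cosh (h ω) * F ω) :=
  fun _ _ K K' C x h F hH hK' hh hF =>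
    (c2_integrate Finset.univ K K' C x h hH (fun i _ => hK' i) hh F hF).2

end Summit.CriticalPhenomena.Ising3DConformalLimit.Cruxes.InverseMFerromagnet.PartialCovarianceLadder
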